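import Summits.QuantumFields.YangMills.Theorems.BalabanUVNodesN15FullPropagatorEntry2Rows
import Summits.QuantumFields.YangMills.Theorems.BalabanUVNodesN15VectorPieceBackgroundMatrix
import HarnessLib

/-!
# THE ENTRY-2 DEVICE AT BAŁABAN's FULL `U ≡ 1` PROPAGATOR ⊗ 1_𝔤 — product-carrier bridges, the forward-shift device on `𝔤`-valued 1-forms, and THE SHIFT-DEFECT
# ROW LETTER `𝔇(S′_{+κ} ⊗ 1, S_{+κ} ⊗ 1)∘(C_a∘Σ_ν((G ⊗ 1)∇_ν*)pr_ν) ≤ C·(o₁ + a₀(L^k)^{−α})·e^{−δ|y−y′|_T}` for FIBREWISE-MATRIX coefficient operators `C_a` (dag-n15-c g9,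
# FILE 15; Track-A node N15 = NE2, s1 «background-layer OPERATOR ingredient»)

`--kind proof --supports stmt-QuantumFields-20544 --as helper` (K3⁷; count-neutral).  Imports BY NAME this seat's g8 FILE 4 `…N15FullPropagatorEntry2Rows` (`kingPrV_add`,
`hasMaj_oneStepFwd_gDivAdj`, `comp_sumJ`, `sub_id_comp_comp_eq`, `symbOp_sTinv_sub_one_eq`, `tdistT_blockOf_add_unitVec_le`; through it FILE 1 `sumJ` ∕ `fgrad` ∕
`fgradAdj` ∕ `hasMaj_sumJ_exp`, W1 `hasMaj_pull_comp`, dag-n15-a parts 42∕66) and g0 M4 `…N15VectorPieceBackgroundMatrix` (`tensorId`, `hasMaj_tensorId`, `idef_tensorId`);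
nothing in the tree is modified.

WHY.  FILE 14 `ne2PlusOperator_byParts_matrix` proves `NE2PlusOperator` BY NAME for the NON-ABELIAN (matrix-coefficient) first-order species on product carriers `X × ι` from
UNIFORM `U ≡ 1` letters; its located torus instance at `tensorId ι gOp` (HANDOFF §g8 (ii-b)) needs those letters for Bałaban's full propagator acting componentwise on
`𝔤 ≅ ℝ^ι`-valued 1-forms.  Twelve of them are FILE 8's `uniform_layer_fullG` letters tensored with `1_ι` (M4 `hasMaj_tensorId` ∕ `idef_tensorId`) once the lifted translations
and difference quotients are recognised as componentwise lifts (§1); the thirteenth — the SHIFT-DEFECT ROW LETTER with a fibrewise-matrix coefficient operator — is NOT a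
componentwise lift (the coefficient mixes colour components) and is proved here by the product-carrier twin of FILE 4 §3–§4: through King's pairing the defect of the two lifted
forward shifts VANISHES on the upper block face and is (minus) the one-step forward difference inside (§2), and `(S_{+κ} − 1)C_aΣ = (C_a⁺ − C_a)S_{+κ}Σ + C_a(S_{+κ} − 1)Σ` costs the
oscillation letter `o₁` resp. the Hölder step of `G∇*` ([B4-I] (1.111), dag-n15-a part 66 via FILE 4 `hasMaj_oneStepFwd_gDivAdj`) tensored with `1_ι` (§3).

CONTENTS ([folklore] bookkeeping + the cited inputs; 0 def).
* §1 `pull_liftEquiv_eq_tensorId`, `comp_fgradAdj_liftEquiv`, `fgrad_liftEquiv_comp`, `sub_id_comp_tensorId`, `idef_pull_liftEquiv`, `idef_comp_fgradAdj_liftEquiv`.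
* §2 `idef_fshift_lift_apply`, ★ `hasMaj_idefFShift_comp_lift`, `hasMaj_fshift_comp_lift`.
* §3 ★★ **`hasMaj_shiftDefect_fullGM`**.

HONEST FRAMING ∕ LIMITS.  `U ≡ 1` torus family at fixed coupling `b`, the propagator GENUINE (`gOp ⊗ 1_ι`); the coefficient operator and its letters are DISPLAYED (the species'
business: FILE 16 feeds the entrywise block averages of matrix coefficient fields); constants crude and ours; one letter of the located torus instance — not a (3.42) entry, not a
node face.  NE2⁺ NOT PRINTED, NOT proved, not claimed; count-neutral (typed 28∕28 · discharged 5∕27 of record unchanged); N15 NOT discharged; one finite T⁴ at fixed ε — NOT ℝ⁴,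
NOT infinite volume, NOT OS, NOT a mass gap, NOT Clay.
-/

noncomputable section

open scoped BigOperators
open Finset

namespace Summit.QuantumFields.YangMills.BalabanUVNodes.N15.BackgroundLayer

open Literature.MathematicalPhysics.QuantumFieldTheory.Balaban1983to89
open Literature.MathematicalPhysics.QuantumFieldTheory.Balaban1983to89.B11SectG (BlockNorm HasMaj RowSum hasMaj_comp hasMaj_comp_exp)
open Literature.MathematicalPhysics.QuantumFieldTheory.Balaban1983to89.T4EtaRateDefect (idef idef_apply idef_comp idef_add)
open Literature.MathematicalPhysics.QuantumFieldTheory.Balaban1983to89.T4EtaRateCoeffDefect (pull pull_apply diagK diagK_nonneg)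
open Literature.MathematicalPhysics.QuantumFieldTheory.Balaban1983to89.B11AxialTransport190 (abs_le_loc_ofBlocks loc_ofBlocks_le)
open Literature.MathematicalPhysics.QuantumFieldTheory.Balaban1983to89.B5Prop11Plancherel (Tor fine unitVec)
open Literature.MathematicalPhysics.QuantumFieldTheory.Balaban1983to89.B5SiteBridgeP12 (MP)
open Literature.MathematicalPhysics.QuantumFieldTheory.Balaban1983to89.B6UnitTorusCarrier (unitTorusGeo triangle254_unitTorusGeo rowSum_unitTorusGeo)
open Literature.MathematicalPhysics.QuantumFieldTheory.King1986.Torus (blockOf tdistT tdistT_nonneg tdistT_self tdistT_symm tdistT_triangle)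
open Summit.QuantumFields.YangMills.BalabanUVNodes.N15.MatrixSpecies (liftMap liftBlk liftEquiv liftEquiv_apply liftEquiv_symm_apply)
open Summit.QuantumFields.YangMills.BalabanUVNodes.N15.SiteLayer (hasMaj_exp_comp_diagK hasMaj_diagK_comp_exp hasMaj_add_exp hasMaj_exp_mono)
open Summit.QuantumFields.YangMills.BalabanUVNodes.N15.TwoGrid (gOp symbOp sT sTinv sD ineq110_114_pair hasMaj_gDivAdj_of_ineq paramsOf hasMaj_rate_mono)
open Summit.QuantumFields.YangMills.BalabanUVNodes.N15.VectorPiece (blkFine kingPrV kingPrV_eq blkFine_comp_kingPrV bshiftEquiv bshiftEquiv_apply bshiftEquiv_symm_apply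
  kingPr_add_unitVec tdistT_blockOf_sub_unitVec_le hasMaj_pull_comp tensorId tensorId_apply hasMaj_tensorId idef_tensorId)

variable {d : ℕ}

/-! ## §1 Bridges: the lifted translations and difference quotients on `X × ι` are componentwise lifts -/

section Bridges

variable {X X' : Type} (ι : Type)

/-- the lifted translation `S_e = pull (liftEquiv e ι)` IS `(pull e) ⊗ 1_ι`. [folklore] -/
theorem pull_liftEquiv_eq_tensorId (e : X ≃ X) : pull ⇑(liftEquiv e ι) = tensorId ι (pull ⇑e) :=
  LinearMap.ext fun _ => funext fun _ => rfl

/-- `(T ⊗ 1)∘∇̂_e* = (T∘∇_e*) ⊗ 1` for the lifted adjoint difference quotient `∇̂_e* = fgradAdj n (liftEquiv e ι)`. [folklore] -/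
theorem comp_fgradAdj_liftEquiv (T : (X → ℝ) →ₗ[ℝ] (X → ℝ)) (n : ℝ) (e : X ≃ X) :
    tensorId ι T ∘ₗ fgradAdj n (liftEquiv e ι) = tensorId ι (T ∘ₗ fgradAdj n e) := by
  refine LinearMap.ext fun f => funext fun p => ?_
  show T (fun x => fgradAdj n (liftEquiv e ι) f (x, p.2)) p.1 = T (fgradAdj n e fun x => f (x, p.2)) p.1
  exact congrArg (fun g => T g p.1) (funext fun x => by simp only [fgradAdj_apply, liftEquiv_symm_apply])

/-- `∇̂_e∘(T ⊗ 1) = (∇_e∘T) ⊗ 1` for the lifted forward difference quotient `∇̂_e = fgrad n (liftEquiv e ι)`. [folklore] -/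
theorem fgrad_liftEquiv_comp {X₂ : Type} (n : ℝ) (e : X ≃ X) (T : (X₂ → ℝ) →ₗ[ℝ] (X → ℝ)) :
    fgrad n (liftEquiv e ι) ∘ₗ tensorId ι T = tensorId ι (fgrad n e ∘ₗ T) := by
  refine LinearMap.ext fun f => funext fun p => ?_
  simp only [LinearMap.comp_apply, fgrad_apply, tensorId_apply, liftEquiv_apply]

/-- `(S_e ⊗ 1 − 1)∘(T ⊗ 1) = ((S_e − 1)∘T) ⊗ 1`. [folklore] -/
theorem sub_id_comp_tensorId {X₂ : Type} (e : X ≃ X) (T : (X₂ → ℝ) →ₗ[ℝ] (X → ℝ)) :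
    (pull ⇑(liftEquiv e ι) - LinearMap.id) ∘ₗ tensorId ι T = tensorId ι ((pull ⇑e - LinearMap.id) ∘ₗ T) := by
  refine LinearMap.ext fun f => funext fun p => ?_
  simp only [LinearMap.comp_apply, LinearMap.sub_apply, LinearMap.id_apply, Pi.sub_apply, pull_apply, tensorId_apply, liftEquiv_apply]

/-- THE TWO-GRID DEFECT OF THE LIFTED SHIFTS is the lift of the defect of the shifts: `𝔇(S′_{e′} ⊗ 1, S_e ⊗ 1) = 𝔇(S′_{e′}, S_e) ⊗ 1` through the lifted pairing `liftMap π ι`.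
[folklore] -/
theorem idef_pull_liftEquiv (π : X' → X) (e' : X' ≃ X') (e : X ≃ X) :
    idef (pull (liftMap π ι)) (pull (liftMap π ι)) (pull ⇑(liftEquiv e' ι)) (pull ⇑(liftEquiv e ι)) = tensorId ι (idef (pull π) (pull π) (pull ⇑e') (pull ⇑e)) := by
  rw [pull_liftEquiv_eq_tensorId, pull_liftEquiv_eq_tensorId, idef_tensorId]

/-- THE TWO-GRID DEFECT OF THE LIFTED ENTRY-2 OPERATORS `(T ⊗ 1)∇̂*` is the lift of the defect of `T∇*`. [folklore] -/
theorem idef_comp_fgradAdj_liftEquiv (π : X' → X) (T' : (X' → ℝ) →ₗ[ℝ] (X' → ℝ)) (T : (X → ℝ) →ₗ[ℝ] (X → ℝ)) (n' n : ℝ) (e' : X' ≃ X') (e : X ≃ X) :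
    idef (pull (liftMap π ι)) (pull (liftMap π ι)) (tensorId ι T' ∘ₗ fgradAdj n' (liftEquiv e' ι)) (tensorId ι T ∘ₗ fgradAdj n (liftEquiv e ι)) =
      tensorId ι (idef (pull π) (pull π) (T' ∘ₗ fgradAdj n' e') (T ∘ₗ fgradAdj n e)) := by
  rw [comp_fgradAdj_liftEquiv, comp_fgradAdj_liftEquiv, idef_tensorId]

end Bridges

/-! ## §2 The defect of the two lifted forward shifts through King's pairing is majorised by the one-step forward difference; the lifted forward shift costs `e^{ρ}` -/

section Device

variable {L : ℕ} [NeZero L] (ι : Type) [Fintype ι] (M : Fin (d + 1) → ℕ) [∀ μ, NeZero (M μ)] (k m : ℕ)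

omit [NeZero L] [Fintype ι] [∀ μ, NeZero (M μ)] in
/-- THE DEFECT OF THE TWO LIFTED FORWARD SHIFTS, pointwise: `𝔇(S′_{+κ} ⊗ 1, S_{+κ} ⊗ 1)g ((x′, a), i) = g((prV(x′ + e′_κ, a)), i) − g((pr x′ + e_κ, a), i)`. [folklore] -/
theorem idef_fshift_lift_apply (κ : Fin (d + 1)) (g : (Tor (fine (L ^ k) M) × Fin (d + 1)) × ι → ℝ) (p : (Tor (fine (L ^ m * L ^ k) M) × Fin (d + 1)) × ι) :
    idef (pull (liftMap (kingPrV L k m M) ι)) (pull (liftMap (kingPrV L k m M) ι)) (pull ⇑(liftEquiv (bshiftEquiv M (L ^ m * L ^ k) κ) ι))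
        (pull ⇑(liftEquiv (bshiftEquiv M (L ^ k) κ) ι)) g p =
      g (kingPrV L k m M (p.1.1 + unitVec (fine (L ^ m * L ^ k) M) κ, p.1.2), p.2) -
        g (((kingPrV L k m M p.1).1 + unitVec (fine (L ^ k) M) κ, (kingPrV L k m M p.1).2), p.2) := rfl

/-- ★ **THE DEFECT OF THE TWO LIFTED FORWARD SHIFTS IS MAJORISED BY THE ONE-STEP FORWARD DIFFERENCE** (product-carrier twin of FILE 4 `hasMaj_idefFShift_comp`): through King's
bond pairing lifted to `𝔤 ≅ ℝ^ι`-valued 1-forms (the colour index a spectator), `𝔇(S′_{+κ} ⊗ 1, S_{+κ} ⊗ 1)∘T` has every block majorant `K ≥ 0` that `(S_{+κ} ⊗ 1 − 1)∘T` has —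
the defect VANISHES on the upper `κ`-face of the block and is (minus) the one-step forward difference inside it. [cite: King1986, p.664 (pairing convention «x′ ∈ B^n(x)»: the mechanism)] -/
theorem hasMaj_idefFShift_comp_lift {F₁ : Type} [AddCommGroup F₁] [Module ℝ F₁] {b₁ : BlockNorm (unitTorusGeo L k M) F₁}
    {T : F₁ →ₗ[ℝ] ((Tor (fine (L ^ k) M) × Fin (d + 1)) × ι → ℝ)} {K : (unitTorusGeo L k M).Site → (unitTorusGeo L k M).Site → ℝ} (hK : ∀ y y', 0 ≤ K y y')
    (κ : Fin (d + 1))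
    (h : HasMaj b₁ (BlockNorm.ofBlocks (unitTorusGeo L k M) (liftBlk (blkFine L k M) ι)) ((pull ⇑(liftEquiv (bshiftEquiv M (L ^ k) κ) ι) - LinearMap.id) ∘ₗ T) K) :
    HasMaj b₁ (BlockNorm.ofBlocks (unitTorusGeo L k M) (liftBlk (blkFine L k M ∘ kingPrV L k m M) ι))
      (idef (pull (liftMap (kingPrV L k m M) ι)) (pull (liftMap (kingPrV L k m M) ι)) (pull ⇑(liftEquiv (bshiftEquiv M (L ^ m * L ^ k) κ) ι))
        (pull ⇑(liftEquiv (bshiftEquiv M (L ^ k) κ) ι)) ∘ₗ T) K := by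
  intro y' μ hμ y
  refine loc_ofBlocks_le _ _ (mul_nonneg (hK y y') (b₁.loc_nonneg y' μ)) fun p hp => ?_
  rw [LinearMap.comp_apply, idef_fshift_lift_apply]
  rcases kingPrV_add M k m p.1 κ with hc | hc
  · -- inside the block: (minus) the one-step forward difference at the paired bond, same colour component
    rw [hc]
    have hval : (((pull ⇑(liftEquiv (bshiftEquiv M (L ^ k) κ) ι) - LinearMap.id) ∘ₗ T : F₁ →ₗ[ℝ] ((Tor (fine (L ^ k) M) × Fin (d + 1)) × ι → ℝ)) μ)
        (kingPrV L k m M p.1, p.2) = T μ (((kingPrV L k m M p.1).1 + unitVec (fine (L ^ k) M) κ, (kingPrV L k m M p.1).2), p.2) - T μ (kingPrV L k m M p.1, p.2) := rfl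
    rw [show T μ (kingPrV L k m M p.1, p.2) - T μ (((kingPrV L k m M p.1).1 + unitVec (fine (L ^ k) M) κ, (kingPrV L k m M p.1).2), p.2) =
      -((((pull ⇑(liftEquiv (bshiftEquiv M (L ^ k) κ) ι) - LinearMap.id) ∘ₗ T : F₁ →ₗ[ℝ] ((Tor (fine (L ^ k) M) × Fin (d + 1)) × ι → ℝ)) μ) (kingPrV L k m M p.1, p.2))
      by rw [hval, neg_sub], abs_neg]
    have hp' : liftBlk (blkFine L k M) ι (kingPrV L k m M p.1, p.2) = y := hp
    exact (abs_le_loc_ofBlocks (g := unitTorusGeo L k M) (liftBlk (blkFine L k M) ι) _ hp').trans (h y' μ hμ y)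
  · -- on the upper face: the two shifts are paired, the defect vanishes
    rw [hc, sub_self, abs_zero]
    exact mul_nonneg (hK y y') (b₁.loc_nonneg y' μ)

omit [NeZero L] in
/-- **THE LIFTED FORWARD SHIFT COSTS A FACTOR `e^{ρ}`** (product-carrier twin of FILE 4 `hasMaj_fshift_comp`): if `T` has the block majorant `B·e^{−ρ|y−y′|_T}` (`B, ρ ≥ 0`) into the
`𝔤`-valued level-`n` 1-forms blocked by the unit block of their base point, then `(S_{+κ} ⊗ 1)∘T` has `B·e^{ρ}·e^{−ρ|y−y′|_T}`. [cite: Balaban1984PropagatorsII, (2.52)–(2.55) pp.232–233 (block-majorant bookkeeping, shape)] -/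
theorem hasMaj_fshift_comp_lift (n : ℕ) [NeZero n] {F₁ : Type} [AddCommGroup F₁] [Module ℝ F₁] {b₁ : BlockNorm (unitTorusGeo L k M) F₁}
    {T : F₁ →ₗ[ℝ] ((Tor (fine n M) × Fin (d + 1)) × ι → ℝ)} {B ρ : ℝ} (hB : 0 ≤ B) (hρ : 0 ≤ ρ) (κ : Fin (d + 1))
    (h : HasMaj b₁ (BlockNorm.ofBlocks (unitTorusGeo L k M) (liftBlk (fun i : Tor (fine n M) × Fin (d + 1) => blockOf n M i.1) ι)) T
      (fun y y' => B * Real.exp (-(ρ * tdistT M y y')))) :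
    HasMaj b₁ (BlockNorm.ofBlocks (unitTorusGeo L k M) (liftBlk (fun i : Tor (fine n M) × Fin (d + 1) => blockOf n M i.1) ι))
      (pull ⇑(liftEquiv (bshiftEquiv M n κ) ι) ∘ₗ T) (fun y y' => B * Real.exp ρ * Real.exp (-(ρ * tdistT M y y'))) := by
  refine hasMaj_pull_comp (g := unitTorusGeo L k M) (liftBlk (fun i : Tor (fine n M) × Fin (d + 1) => blockOf n M i.1) ι) ⇑(liftEquiv (bshiftEquiv M n κ) ι)
    (fun _ _ => mul_nonneg (mul_nonneg hB (Real.exp_nonneg _)) (Real.exp_nonneg _)) (fun p y' => ?_) h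
  show B * Real.exp (-(ρ * tdistT M (blockOf n M (bshiftEquiv M n κ p.1).1) y')) ≤ B * Real.exp ρ * Real.exp (-(ρ * tdistT M (blockOf n M p.1.1) y'))
  rw [bshiftEquiv_apply, mul_assoc, ← Real.exp_add]
  refine mul_le_mul_of_nonneg_left (Real.exp_le_exp.mpr ?_) hB
  have h1 := tdistT_triangle M (blockOf n M p.1.1) (blockOf n M (p.1.1 + unitVec (fine n M) κ)) y'
  have h2 : tdistT M (blockOf n M p.1.1) (blockOf n M (p.1.1 + unitVec (fine n M) κ)) ≤ 1 := by
    rw [tdistT_symm]; exact tdistT_blockOf_add_unitVec_le M n p.1.1 κ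
  nlinarith

end Device

/-! ## §3 THE SHIFT-DEFECT ROW LETTER at Bałaban's full `U ≡ 1` propagator ⊗ 1_𝔤, fibrewise-matrix coefficient operators -/

section FullGM

variable {L : ℕ} [NeZero L] (ι : Type) [Fintype ι]

/-- ★★ **THE SHIFT-DEFECT ROW LETTER AT BAŁABAN's FULL `U ≡ 1` PROPAGATOR ⊗ 1_𝔤.**  For odd `L ≥ 3`, `b > 0`, `0 ≤ α < 1` there are `δ, C > 0` such that, on the torus family of
record (`M_μ = 2L^{m_T}`, coarse spacing `L^{−k}`, fine `L^{−m−k}`, King's pairing) and on `𝔤 ≅ ℝ^ι`-valued 1-forms, for every direction `κ` and every coefficient operator `C_a` on the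
coarse `𝔤`-valued 1-forms INTERTWINING the lifted coarse shift — `(S_{+κ} ⊗ 1)∘C_a = C_a⁺∘(S_{+κ} ⊗ 1)` with `C_a ≤ diagK a₀`, `C_a⁺ − C_a ≤ diagK o₁` (`a₀, o₁ ≥ 0`; e.g. the fibrewise
matrix multiplication `M_{A∘e⁻¹}` by a translated matrix coefficient field, FILE 12 `mmulOp_comp_pull`) — the shift-defect row letter of FILE 14 `ne2PlusOperator_byParts_matrix` holds
with `Σ = Σ_ν ((G ⊗ 1)∇_ν*) pr_ν`, `G = gOp`, `∇_ν* = fgradAdj (L^k) (liftEquiv (bshiftEquiv ν) ι)`: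
`𝔇(S′_{+κ} ⊗ 1, S_{+κ} ⊗ 1)∘(C_a∘Σ) ≤ C·(o₁ + a₀·(L^k)^{−α})·e^{−δ|y−y′|_T}`.  Two-grid content as in FILE 4 ★★: the defect of the lifted shifts vanishes on the block face and is
the one-step forward difference inside (§2); `(S − 1)C_aΣ = (C_a⁺ − C_a)SΣ + C_a(S − 1)Σ`; the first term costs the oscillation letter, the second the Hölder step of `G∇*` (FILE 4
`hasMaj_oneStepFwd_gDivAdj`, tensored with `1_ι` by §1 + M4 `hasMaj_tensorId`). [cite: Balaban1984PropagatorsI, Prop. 1.2 (1.110)–(1.111) p.35; Balaban1985BackgroundPropagators, (3.52) p.400 + (3.64)–(3.65) p.402 (mechanism); Balaban1984PropagatorsII, (2.156) p.250 (the `U ≡ 1` propagator on `𝔤`-valued forms); King1986, p.664] -/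
theorem hasMaj_shiftDefect_fullGM (hLodd : Odd L) (hL2 : 2 ≤ L) {b : ℝ} (hb : 0 < b) {α : ℝ} (hα0 : 0 ≤ α) (hα1 : α < 1) :
    ∃ δ C : ℝ, 0 < δ ∧ 0 < C ∧ ∀ (mT k m : ℕ) (_hk : 1 ≤ k) (hL : Odd L ∧ 1 < L) (κ : Fin (d + 1))
      (Ca Cap : ((Tor (fine (L ^ k) (MP (paramsOf d L mT k hL))) × Fin (d + 1)) × ι → ℝ) →ₗ[ℝ]
        ((Tor (fine (L ^ k) (MP (paramsOf d L mT k hL))) × Fin (d + 1)) × ι → ℝ))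
      (a₀ o₁ : ℝ), 0 ≤ a₀ → 0 ≤ o₁ →
      pull ⇑(liftEquiv (bshiftEquiv (MP (paramsOf d L mT k hL)) (L ^ k) κ) ι) ∘ₗ Ca = Cap ∘ₗ pull ⇑(liftEquiv (bshiftEquiv (MP (paramsOf d L mT k hL)) (L ^ k) κ) ι) →
      HasMaj (BlockNorm.ofBlocks (unitTorusGeo L k (MP (paramsOf d L mT k hL))) (liftBlk (blkFine L k (MP (paramsOf d L mT k hL))) ι))
        (BlockNorm.ofBlocks (unitTorusGeo L k (MP (paramsOf d L mT k hL))) (liftBlk (blkFine L k (MP (paramsOf d L mT k hL))) ι)) Ca (diagK fun _ => a₀) →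
      HasMaj (BlockNorm.ofBlocks (unitTorusGeo L k (MP (paramsOf d L mT k hL))) (liftBlk (blkFine L k (MP (paramsOf d L mT k hL))) ι))
        (BlockNorm.ofBlocks (unitTorusGeo L k (MP (paramsOf d L mT k hL))) (liftBlk (blkFine L k (MP (paramsOf d L mT k hL))) ι)) (Cap - Ca) (diagK fun _ => o₁) →
      HasMaj (BlockNorm.ofBlocks (unitTorusGeo L k (MP (paramsOf d L mT k hL))) (liftBlk (liftBlk (blkFine L k (MP (paramsOf d L mT k hL))) ι) (Fin (d + 1))))
        (BlockNorm.ofBlocks (unitTorusGeo L k (MP (paramsOf d L mT k hL))) (liftBlk (blkFine L k (MP (paramsOf d L mT k hL)) ∘ kingPrV L k m (MP (paramsOf d L mT k hL))) ι))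
        (idef (pull (liftMap (kingPrV L k m (MP (paramsOf d L mT k hL))) ι)) (pull (liftMap (kingPrV L k m (MP (paramsOf d L mT k hL))) ι))
            (pull ⇑(liftEquiv (bshiftEquiv (MP (paramsOf d L mT k hL)) (L ^ m * L ^ k) κ) ι)) (pull ⇑(liftEquiv (bshiftEquiv (MP (paramsOf d L mT k hL)) (L ^ k) κ) ι)) ∘ₗ
          (Ca ∘ₗ sumJ fun ν => tensorId ι (gOp (MP (paramsOf d L mT k hL)) (L ^ k) b) ∘ₗ
            fgradAdj ((L ^ k : ℕ) : ℝ) (liftEquiv (bshiftEquiv (MP (paramsOf d L mT k hL)) (L ^ k) ν) ι)))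
        (fun y y' => C * (o₁ + a₀ * ((L ^ k : ℕ) : ℝ) ^ (-α)) * Real.exp (-(δ * tdistT (MP (paramsOf d L mT k hL)) y y'))) := by
  have hL : Odd L ∧ 1 < L := ⟨hLodd, by omega⟩
  have hL0 : 0 < L := by omega
  obtain ⟨δ₁, C₁, hδ₁, hC₁, HH⟩ := hasMaj_oneStepFwd_gDivAdj (d := d) hLodd hL2 hb hα0 hα1
  obtain ⟨δ₀, C₀, Cα, Cε, Cαε, hδ₀, hC₀, HP⟩ := ineq110_114_pair (d := d) hL hb
  set δ : ℝ := min δ₀ δ₁ with hδdef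
  have hδ : 0 < δ := lt_min hδ₀ hδ₁
  set C : ℝ := Real.exp δ * ((d + 1 : ℕ) * C₀) + (d + 1 : ℕ) * C₁ with hCdef
  have hC : 0 < C := by positivity
  refine ⟨δ, C, hδ, hC, fun mT k m hk hL' κ Ca Cap a₀ o₁ ha₀ ho₁ hCaS hCa hOsc => ?_⟩
  have hn1 : 1 ≤ L ^ k := Nat.one_le_pow _ _ hL0
  have hnpos : (0 : ℝ) < ((L ^ k : ℕ) : ℝ) := by exact_mod_cast Nat.pos_of_ne_zero (by positivity)
  have hrα : 0 ≤ ((L ^ k : ℕ) : ℝ) ^ (-α) := Real.rpow_nonneg hnpos.le _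
  have hK0 : ∀ y y' : (unitTorusGeo L k (MP (paramsOf d L mT k hL'))).Site, 0 ≤ C₀ * Real.exp (-(δ * tdistT (MP (paramsOf d L mT k hL')) y y')) := fun _ _ => mul_nonneg hC₀.le (Real.exp_nonneg _)
  have hK1 : ∀ y y' : (unitTorusGeo L k (MP (paramsOf d L mT k hL'))).Site, 0 ≤ C₁ * ((L ^ k : ℕ) : ℝ) ^ (-α) * Real.exp (-(δ * tdistT (MP (paramsOf d L mT k hL')) y y')) :=
    fun _ _ => mul_nonneg (mul_nonneg hC₁.le hrα) (Real.exp_nonneg _)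
  -- the (1.110) majorant of `S_ν = (G ⊗ 1)∇_ν* = (G∇_ν*) ⊗ 1` at the common rate, of `Σ`, of `(S_{+κ} ⊗ 1)Σ`
  obtain ⟨HP1, -⟩ := HP mT k m hk
  have hS : ∀ ν, HasMaj (BlockNorm.ofBlocks (unitTorusGeo L k (MP (paramsOf d L mT k hL'))) (liftBlk (blkFine L k (MP (paramsOf d L mT k hL'))) ι)) (BlockNorm.ofBlocks (unitTorusGeo L k (MP (paramsOf d L mT k hL'))) (liftBlk (blkFine L k (MP (paramsOf d L mT k hL'))) ι))
      (tensorId ι (gOp (MP (paramsOf d L mT k hL')) (L ^ k) b) ∘ₗ fgradAdj ((L ^ k : ℕ) : ℝ) (liftEquiv (bshiftEquiv (MP (paramsOf d L mT k hL')) (L ^ k) ν) ι)) (fun y y' => C₀ * Real.exp (-(δ * tdistT (MP (paramsOf d L mT k hL')) y y'))) := fun ν => by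
    rw [comp_fgradAdj_liftEquiv, ← symbOp_sTinv_sub_one_eq]
    exact hasMaj_tensorId ι hK0 (hasMaj_rate_mono hC₀.le (min_le_left δ₀ δ₁) (hasMaj_gDivAdj_of_ineq (MP (paramsOf d L mT k hL')) k (L ^ k) b hn1 HP1 hC₀.le ν))
  have hSig := hasMaj_sumJ_exp (g := unitTorusGeo L k (MP (paramsOf d L mT k hL'))) (liftBlk (blkFine L k (MP (paramsOf d L mT k hL'))) ι) (b₂ := BlockNorm.ofBlocks (unitTorusGeo L k (MP (paramsOf d L mT k hL'))) (liftBlk (blkFine L k (MP (paramsOf d L mT k hL'))) ι)) hC₀.le hS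
  have hSsig := hasMaj_fshift_comp_lift ι (MP (paramsOf d L mT k hL')) k (L ^ k) (b₁ := BlockNorm.ofBlocks (unitTorusGeo L k (MP (paramsOf d L mT k hL'))) (liftBlk (liftBlk (blkFine L k (MP (paramsOf d L mT k hL'))) ι) (Fin (d + 1))))
    (mul_nonneg (Nat.cast_nonneg _) hC₀.le) hδ.le κ hSig
  -- term A: `(C_a⁺ − C_a)(S ⊗ 1)Σ ≤ o₁·e^{δ}|J|C₀·e^{−δd}`
  have hA := hasMaj_diagK_comp_exp (b₁ := BlockNorm.ofBlocks (unitTorusGeo L k (MP (paramsOf d L mT k hL'))) (liftBlk (liftBlk (blkFine L k (MP (paramsOf d L mT k hL'))) ι) (Fin (d + 1))))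
    (b₃ := BlockNorm.ofBlocks (unitTorusGeo L k (MP (paramsOf d L mT k hL'))) (liftBlk (blkFine L k (MP (paramsOf d L mT k hL'))) ι)) (liftBlk (blkFine L k (MP (paramsOf d L mT k hL'))) ι) ho₁ hOsc hSsig
  -- term B: `C_a((S ⊗ 1) − 1)Σ ≤ a₀·|J|C₁(L^k)^{−α}·e^{−δd}` — the Hölder step of `G∇*`, tensored with `1_ι`
  have hstep : ∀ ν, HasMaj (BlockNorm.ofBlocks (unitTorusGeo L k (MP (paramsOf d L mT k hL'))) (liftBlk (blkFine L k (MP (paramsOf d L mT k hL'))) ι)) (BlockNorm.ofBlocks (unitTorusGeo L k (MP (paramsOf d L mT k hL'))) (liftBlk (blkFine L k (MP (paramsOf d L mT k hL'))) ι))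
      ((pull ⇑(liftEquiv (bshiftEquiv (MP (paramsOf d L mT k hL')) (L ^ k) κ) ι) - LinearMap.id) ∘ₗ
        (tensorId ι (gOp (MP (paramsOf d L mT k hL')) (L ^ k) b) ∘ₗ fgradAdj ((L ^ k : ℕ) : ℝ) (liftEquiv (bshiftEquiv (MP (paramsOf d L mT k hL')) (L ^ k) ν) ι)))
      (fun y y' => C₁ * ((L ^ k : ℕ) : ℝ) ^ (-α) * Real.exp (-(δ * tdistT (MP (paramsOf d L mT k hL')) y y'))) := fun ν => by
    rw [comp_fgradAdj_liftEquiv, sub_id_comp_tensorId]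
    exact hasMaj_tensorId ι hK1 (hasMaj_rate_mono (mul_nonneg hC₁.le hrα) (min_le_right δ₀ δ₁) (HH mT k m hk hL' κ ν))
  have hSig' := hasMaj_sumJ_exp (g := unitTorusGeo L k (MP (paramsOf d L mT k hL'))) (liftBlk (blkFine L k (MP (paramsOf d L mT k hL'))) ι) (b₂ := BlockNorm.ofBlocks (unitTorusGeo L k (MP (paramsOf d L mT k hL'))) (liftBlk (blkFine L k (MP (paramsOf d L mT k hL'))) ι))
    (mul_nonneg hC₁.le hrα) hstep
  have hSig'' := hSig'.congr fun u => (LinearMap.congr_fun (comp_sumJ (pull ⇑(liftEquiv (bshiftEquiv (MP (paramsOf d L mT k hL')) (L ^ k) κ) ι) - LinearMap.id)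
    (fun ν => tensorId ι (gOp (MP (paramsOf d L mT k hL')) (L ^ k) b) ∘ₗ fgradAdj ((L ^ k : ℕ) : ℝ) (liftEquiv (bshiftEquiv (MP (paramsOf d L mT k hL')) (L ^ k) ν) ι))) u).symm
  have hB := hasMaj_diagK_comp_exp (b₁ := BlockNorm.ofBlocks (unitTorusGeo L k (MP (paramsOf d L mT k hL'))) (liftBlk (liftBlk (blkFine L k (MP (paramsOf d L mT k hL'))) ι) (Fin (d + 1))))
    (b₃ := BlockNorm.ofBlocks (unitTorusGeo L k (MP (paramsOf d L mT k hL'))) (liftBlk (blkFine L k (MP (paramsOf d L mT k hL'))) ι)) (liftBlk (blkFine L k (MP (paramsOf d L mT k hL'))) ι) ha₀ hCa hSig''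
  have hkey : o₁ * (((Fintype.card (Fin (d + 1)) : ℕ) : ℝ) * C₀ * Real.exp δ) + a₀ * (((Fintype.card (Fin (d + 1)) : ℕ) : ℝ) * (C₁ * ((L ^ k : ℕ) : ℝ) ^ (-α))) ≤
      C * (o₁ + a₀ * ((L ^ k : ℕ) : ℝ) ^ (-α)) := by
    rw [Fintype.card_fin, hCdef]
    have h1 : 0 ≤ ((d + 1 : ℕ) : ℝ) * C₁ * o₁ := by positivity
    have h2 : 0 ≤ Real.exp δ * (((d + 1 : ℕ) : ℝ) * C₀) * (a₀ * ((L ^ k : ℕ) : ℝ) ^ (-α)) := by positivity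
    nlinarith
  have hsum := (hasMaj_add_exp hA hB).mono fun y y' => (mul_le_mul_of_nonneg_right hkey (Real.exp_nonneg (-(δ * tdistT (MP (paramsOf d L mT k hL')) y y'))))
  -- the device: it suffices to majorise `((S ⊗ 1) − 1)∘(C_a∘Σ) = (C_a⁺ − C_a)(S ⊗ 1)Σ + C_a((S ⊗ 1) − 1)Σ`
  refine hasMaj_idefFShift_comp_lift ι (MP (paramsOf d L mT k hL')) k m
    (b₁ := BlockNorm.ofBlocks (unitTorusGeo L k (MP (paramsOf d L mT k hL'))) (liftBlk (liftBlk (blkFine L k (MP (paramsOf d L mT k hL'))) ι) (Fin (d + 1))))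
    (fun _ _ => mul_nonneg (mul_nonneg hC.le (by positivity)) (Real.exp_nonneg _)) κ
    (hsum.congr fun u => (LinearMap.congr_fun (sub_id_comp_comp_eq _ Ca Cap _ hCaS) u).symm)

end FullGM

end Summit.QuantumFields.YangMills.BalabanUVNodes.N15.BackgroundLayer

end
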